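import Summits.HodgeConjecture.HodgeConjecture.Theorems.F0P3cStCharTSUpDom              -- ★ (LH4-p01): brings `Ch12Sec5.EllipticData` and the (UP-DEF) currency (`finTau`, `finKappaAt`, `IsLocalNormPair`, `IsLocalStablyConjH`, `Gqs`)
import Summits.HodgeConjecture.HodgeConjecture.Theorems.F0P3cStCharTSEllInnerMeasures    -- ★ (E7) p852616 (F0P2-p02): `weylOrder_eq_index`, `inv_weylOrder_cast_eq_inv_index_cast`
import Literature.NumberTheory.Rogawski1990.Ch12Sec5                                     -- ★ carpet: `EllipticData.Prop1252`, `InnerGDefined`, `InnerHDefined` (`innerG`∕`innerH` via `Ch12Sec5Defs`)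
import HarnessLib

/-!
# F0 · P3c · line LH6 «StCharTS» — ROAD «ELL-INNER», (E9)-side PRE-DOCK «ELL-INNER DATUM DICTIONARY»: Prop. 12.5.2 in the §12.5 datum's fields
# `𝔇.innerG (𝔇.up α₁) (𝔇.up α₂) = 2 · 𝔇.innerH α₁ α₂` ⟸ the same sentence ON THE CONCRETE LOCAL DATA (★ (E8) `innerG_up_eq_two_mul_innerH_of_inputs`' conclusion shape)
# [Rogawski1990 §12.5 Prop. 12.5.2 pp. 184–185; Lemma 12.5.1 p. 183]

Cell `pub/hodgecm-mathlib`, crux H413 = `stmt-HodgeConjecture-24833` (lane `--kind proof --supports … --as helper`); seat F0P2-p01 (g24); ROAD «ELL-INNER» (LEAD T14-40∕T14-44;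
map owner ∕ E-dealer LH6-p03 (g7), who dealt this PRE-DOCK 20:24:04Z; (E9) rider pen LH6-p01 (g6)).  THEOREMS ONLY (no definition ∕ instance ∕ notation ∕ named fact ∕ `sorry`);
★-only imports.  The EXACT mould of ★ (P1) `F0P3cStCharTSUpTrDatumDict.upTransferLB_of_concrete` (LH3-p02), one organ consequent over.

WHAT.  The ★ analytic head of ROAD «ELL-INNER», (E8) `F0P3cStCharTSEllInnerAssembly.innerG_up_eq_two_mul_innerH_of_inputs` (F0P3a-p06), is stated on the CONCRETE local objects: the
elliptic `G`-Cartan system `Sell` with its compact-core-normalised Haar measures `μTf`, the `H`-Cartan system `SH` with `tH`, ABSTRACT closed forms `dG`, `dH` (instantiated by the rider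
at the `eDG`∕`eDH` radicals), Weyl weights `([N(T):T] : ℂ)⁻¹`, and the up-map SPELLED INLINE by (UP-DEF).  The rider, on the other hand, must produce the block consequent `h1252 :
𝔇.Prop1252` (★ RUNG0 v8 :268; ★ `Ch12Sec5` :141) in the FIELDS of the §12.5 datum `𝔇` under the pins `eCartanG eMuT eCartanH eMuTH eDG eDH hStH hUp eEllH` (★ RUNG0 v8 :166–:199,
texts verbatim).  This file is the DICTIONARY between the two — pure pin rewriting, no analysis:
* **`prop1252_of_concrete`** — GIVEN `hconcrete` = (E8)'s conclusion universally quantified over `α₁ α₂` WITH its six α-hypotheses (`Measurable α₁∕α₂`, stability on the `G`-regular ELLIPTIC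
  set `{a | IsLocalGRegular a ∧ IsCompact Z_H(a)}` w.r.t. ★ `IsLocalStablyConjH`, and the two GIVEN totals `hIG`∕`hIH`), all read at `Sell`, `μTf`, `SH`, `tH := μTHf` and the CLOSED radicals
  for `dG`∕`dH` (β-reduced inline — the (E9) instantiation `dG := fun g => √√radicand_G g`, `dH := fun s => √√radicand_H s`), THEN `𝔇.Prop1252`.
  Proof: `Prop1252`, `innerG`, `innerH`, `InnerGDefined`, `InnerHDefined` unfold (★ `Ch12Sec5` :69–:76 :141–:145, ★ `Ch12Sec5Defs` :235–:243); `weylOrder = [N(T):T]` (★ (E7)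
  `inv_weylOrder_cast_eq_inv_index_cast`, `rfl`); `eCartanG`∕`eCartanH` rewrite the index Finsets, `eMuT`∕`eMuTH` the torus measures, `hUp` then `eDG`∕`eDH` the integrands
  (`funext` + `simp only`), `hStH` + `eEllH` carry `IsStableClassFunOn 𝔇.stConjH 𝔇.ellH` to the concrete stability; then `exact hconcrete …`.
* Only the direction the rider consumes is typed.  The rider's call: `prop1252_of_concrete L v μ 𝔇 Sell μTf SH μTHf eDG eDH hStH hUp eCartanG eMuT eCartanH eMuTH eEllH (fun α₁ α₂ h₁ h₂ h₃ h₄ h₅ h₆ =>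
  F0P3cStCharTSEllInnerAssembly.innerG_up_eq_two_mul_innerH_of_inputs L v … (dG := fun g => …) … (dH := fun s => …) … (tH := μTHf) … α₁ α₂ h₁ h₂ h₃ h₄ h₅ h₆)`.
HONEST LABEL: count-neutral — this file moves no consequent; `𝔇.Prop1252` stays a PRINTED consequent of `hBlock′` until the (E9) rider (one rider per ★ batch, by ★ arrival, D133-SEQ);
HC_CM is proved only modulo the 7 printed citations (2 remaining named inputs: hLiu418 = `stmt-HodgeConjecture-24832`, h413 = `stmt-HodgeConjecture-24833`) until rung 0 closes.

## References
* [Rogawski1990] J. D. Rogawski, *Automorphic Representations of Unitary Groups in Three Variables*, Ann. of Math. Stud. 123 (1990): §12.5 Prop. 12.5.2 pp. 184–185 (`⟨α₁^G, α₂^G⟩_{G,e}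
  = 2⟨α₁, α₂⟩_{H,e}`), Lemma 12.5.1 p. 183 (the formula for `α^G`), p. 184 (the elliptic inner products), §4.9 p. 55 (`D_G`, `D_H`, `τ`), §3.6 p. 29 (`|Ω(T,G)|`).
-/

set_option autoImplicit false
-- the mandated namespace has the single-problem summit's repeated segment (`HodgeConjecture.HodgeConjecture`)
set_option linter.dupNamespace false

noncomputable section

open NumberField IsDedekindDomain MeasureTheory
open scoped Matrix MatrixGroups NNReal Classical
open Literature.NumberTheory.Rogawski1990 Literature.NumberTheory.Automorphic Literature.NumberTheory.Automorphic.UnitaryGroup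
open Literature.NumberTheory.GaloisRepresentations
open Summit.HodgeConjecture.HodgeConjecture.Cruxes.H413

namespace Summit.HodgeConjecture.HodgeConjecture.Cruxes.H413.F0P3cStCharTSEllInnerDatumDict

variable (L : Type) [Field L] [NumberField L] [IsCMField L] (v : HeightOneSpectrum (𝓞 ↥(maximalRealSubfield L)))

set_option maxHeartbeats 3200000 in
set_option synthInstance.maxHeartbeats 400000 in
-- long statement; instance-term unification on the CM local carriers (class of ★ (E8) ∕ ★ (P1))
/-- **(E9) PRE-DOCK «ELL-INNER DATUM DICTIONARY».**  At a §12.5 datum `𝔇` on `(G_v, H_v) = (U(Φ₃)(L⁺_v), (U(Φ₂) × U(Φ₁))(L⁺_v))` whose fields are pinned by `eCartanG`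
(`𝔇.cartanG = Sell`), `eMuT` (`𝔇.μT = μTf`), `eCartanH` (`𝔇.cartanH = SH`), `eMuTH` (`𝔇.μTH = μTHf`), `eDG`∕`eDH` (closed radicals of `D_G`, `D_H`), `hStH` (`𝔇.stConjH ↔`
★ `IsLocalStablyConjH`), `eEllH` (`𝔇.ellH = {G-regular ∧ compact centraliser}`) and the (UP-DEF) field equation `hUp` (texts = ★ RUNG0 v8 :166–:199 verbatim): PROPOSITION 12.5.2
STATED ON THE CONCRETE DATA with `α^G` spelled inline and Weyl weights `([N(T):T] : ℂ)⁻¹` (hypothesis `hconcrete` — the conclusion shape of ★ (E8)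
`innerG_up_eq_two_mul_innerH_of_inputs` at `dG := √√radicand_G`, `dH := √√radicand_H`, `tH := μTHf`, quantified over `α₁ α₂` with its six α-hypotheses) IMPLIES `𝔇.Prop1252`, the block
consequent `h1252` of ★ RUNG0 v8 :268.  Pure pin rewriting. [cite: Rogawski1990, §12.5 Prop. 12.5.2 pp. 184–185; Lemma 12.5.1 p. 183; §3.6 p. 29] -/
theorem prop1252_of_concrete (μ : HeckeCharacter L)
    [MeasurableSpace (Gqs L v)] [∀ γ : Gqs L v, MeasurableSpace (Gqs L v ⧸ Subgroup.centralizer ({γ} : Set (Gqs L v)))]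
    [MeasurableSpace (Gqs L v ⧸ Subgroup.center (Gqs L v))]
    [MeasurableSpace ((UnitaryGroup.cmDatum L 2 (Matrix.of fun i j : Fin 2 => if i.val + j.val + 1 = 2 then (1 : L) else 0)).Local v × (UnitaryGroup.cmDatum L 1 (Matrix.of fun i j : Fin 1 => if i.val + j.val + 1 = 1 then (1 : L) else 0)).Local v)]
    (𝔇 : Ch12Sec5.EllipticData (Gqs L v) ((UnitaryGroup.cmDatum L 2 (Matrix.of fun i j : Fin 2 => if i.val + j.val + 1 = 2 then (1 : L) else 0)).Local v × (UnitaryGroup.cmDatum L 1 (Matrix.of fun i j : Fin 1 => if i.val + j.val + 1 = 1 then (1 : L) else 0)).Local v))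
    -- the concrete Cartan data the pins point to (★ RUNG0 v8 `hBlock′` binders `Sell μTf SH μTHf`)
    (Sell : Finset (Subgroup (Gqs L v))) (μTf : (T' : Subgroup (Gqs L v)) → Measure ↥T')
    (SH : Finset (Subgroup ((UnitaryGroup.cmDatum L 2 (Matrix.of fun i j : Fin 2 => if i.val + j.val + 1 = 2 then (1 : L) else 0)).Local v × (UnitaryGroup.cmDatum L 1 (Matrix.of fun i j : Fin 1 => if i.val + j.val + 1 = 1 then (1 : L) else 0)).Local v))) (μTHf : (T : Subgroup ((UnitaryGroup.cmDatum L 2 (Matrix.of fun i j : Fin 2 => if i.val + j.val + 1 = 2 then (1 : L) else 0)).Local v × (UnitaryGroup.cmDatum L 1 (Matrix.of fun i j : Fin 1 => if i.val + j.val + 1 = 1 then (1 : L) else 0)).Local v)) → Measure ↥T)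
    -- the pins (★ RUNG0 v8 `eDG eDH hStH hUp eCartanG eMuT eCartanH eMuTH eEllH`, texts verbatim)
    (eDG : ∀ g : Gqs L v, 𝔇.DG g = ((NNReal.sqrt (NNReal.sqrt ((∏ w : PlacesOver L v, IsNonarchimedeanLocalField.normAbs (w.1.adicCompletion L) (((g.val : GL (Fin 3) (UnitaryGroup.LocalRing L v)).val.charpoly.discr) w)) * ((∏ w : PlacesOver L v, IsNonarchimedeanLocalField.normAbs (w.1.adicCompletion L) (((g.val : GL (Fin 3) (UnitaryGroup.LocalRing L v)).val.det) w)) ^ 2)⁻¹)) : ℝ≥0) : ℝ))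
    (eDH : ∀ s : ((UnitaryGroup.cmDatum L 2 (Matrix.of fun i j : Fin 2 => if i.val + j.val + 1 = 2 then (1 : L) else 0)).Local v × (UnitaryGroup.cmDatum L 1 (Matrix.of fun i j : Fin 1 => if i.val + j.val + 1 = 1 then (1 : L) else 0)).Local v), 𝔇.DH s = ((NNReal.sqrt (NNReal.sqrt ((∏ w : PlacesOver L v, IsNonarchimedeanLocalField.normAbs (w.1.adicCompletion L) (((s.1.val : GL (Fin 2) (UnitaryGroup.LocalRing L v)).val.charpoly.discr) w)) * (∏ w : PlacesOver L v, IsNonarchimedeanLocalField.normAbs (w.1.adicCompletion L) (((s.1.val : GL (Fin 2) (UnitaryGroup.LocalRing L v)).val.det) w))⁻¹)) : ℝ≥0) : ℝ))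
    (hStH : ∀ a b : ((UnitaryGroup.cmDatum L 2 (Matrix.of fun i j : Fin 2 => if i.val + j.val + 1 = 2 then (1 : L) else 0)).Local v × (UnitaryGroup.cmDatum L 1 (Matrix.of fun i j : Fin 1 => if i.val + j.val + 1 = 1 then (1 : L) else 0)).Local v), 𝔇.stConjH a b ↔ IsLocalStablyConjH L v a b)
    (hUp : ∀ (α : ((UnitaryGroup.cmDatum L 2 (Matrix.of fun i j : Fin 2 => if i.val + j.val + 1 = 2 then (1 : L) else 0)).Local v × (UnitaryGroup.cmDatum L 1 (Matrix.of fun i j : Fin 1 => if i.val + j.val + 1 = 1 then (1 : L) else 0)).Local v) → ℂ) (x : Gqs L v),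
      𝔇.up α x =
        if IsRegularElt (x.val : GL (Fin 3) (UnitaryGroup.LocalRing L v)) then
          ((𝔇.DG x : ℂ))⁻¹ *
            ∑ᶠ q : Quot (IsLocalStablyConjH L v),
              (if IsLocalGRegular L v q.out ∧ IsLocalNormPair L (qsForm L) v q.out x then
                finTau L v q.out μ * (𝔇.DH q.out : ℂ) * ((finKappaAt L v (qsForm L) q.out x : ℤ) : ℂ) * α q.out
              else 0)
        else 0)
    (eCartanG : 𝔇.cartanG = Sell) (eMuT : ∀ T' : Subgroup (Gqs L v), 𝔇.μT T' = μTf T')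
    (eCartanH : 𝔇.cartanH = SH) (eMuTH : ∀ T : Subgroup ((UnitaryGroup.cmDatum L 2 (Matrix.of fun i j : Fin 2 => if i.val + j.val + 1 = 2 then (1 : L) else 0)).Local v × (UnitaryGroup.cmDatum L 1 (Matrix.of fun i j : Fin 1 => if i.val + j.val + 1 = 1 then (1 : L) else 0)).Local v), 𝔇.μTH T = μTHf T)
    (eEllH : ∀ a : ((UnitaryGroup.cmDatum L 2 (Matrix.of fun i j : Fin 2 => if i.val + j.val + 1 = 2 then (1 : L) else 0)).Local v × (UnitaryGroup.cmDatum L 1 (Matrix.of fun i j : Fin 1 => if i.val + j.val + 1 = 1 then (1 : L) else 0)).Local v), a ∈ 𝔇.ellH ↔ IsLocalGRegular L v a ∧ IsCompact ((Subgroup.centralizer ({a} : Set ((UnitaryGroup.cmDatum L 2 (Matrix.of fun i j : Fin 2 => if i.val + j.val + 1 = 2 then (1 : L) else 0)).Local v × (UnitaryGroup.cmDatum L 1 (Matrix.of fun i j : Fin 1 => if i.val + j.val + 1 = 1 then (1 : L) else 0)).Local v)) : Subgroup ((UnitaryGroup.cmDatum L 2 (Matrix.of fun i j : Fin 2 =>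 if i.val + j.val + 1 = 2 then (1 : L) else 0)).Local v × (UnitaryGroup.cmDatum L 1 (Matrix.of fun i j : Fin 1 => if i.val + j.val + 1 = 1 then (1 : L) else 0)).Local v)) : Set ((UnitaryGroup.cmDatum L 2 (Matrix.of fun i j : Fin 2 => if i.val + j.val + 1 = 2 then (1 : L) else 0)).Local v × (UnitaryGroup.cmDatum L 1 (Matrix.of fun i j : Fin 1 => if i.val + j.val + 1 = 1 then (1 : L) else 0)).Local v)))
    -- ★ (E8)'s conclusion shape at the closed radicals and `tH := μTHf`, quantified over `α₁ α₂` with its six α-hypotheses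
    (hconcrete : ∀ α₁ α₂ : ((UnitaryGroup.cmDatum L 2 (Matrix.of fun i j : Fin 2 => if i.val + j.val + 1 = 2 then (1 : L) else 0)).Local v × (UnitaryGroup.cmDatum L 1 (Matrix.of fun i j : Fin 1 => if i.val + j.val + 1 = 1 then (1 : L) else 0)).Local v) → ℂ, Measurable α₁ → Measurable α₂ →
      Ch12Sec5.IsStableClassFunOn (IsLocalStablyConjH L v) {a : ((UnitaryGroup.cmDatum L 2 (Matrix.of fun i j : Fin 2 => if i.val + j.val + 1 = 2 then (1 : L) else 0)).Local v × (UnitaryGroup.cmDatum L 1 (Matrix.of fun i j : Fin 1 => if i.val + j.val + 1 = 1 then (1 : L) else 0)).Local v) | IsLocalGRegular L v a ∧ IsCompact ((Subgroup.centralizer ({a} : Set ((UnitaryGroup.cmDatum L 2 (Matrix.of fun i j : Fin 2 => if i.val + j.val + 1 = 2 then (1 : L) else 0)).Local v × (UnitaryGroup.cmDatum L 1 (Matrix.of fun i j : Fin 1 => if i.val + j.val + 1 = 1 then (1 : L) else 0)).Local v)) : Subgroup ((UnitaryGroup.cmDatum L 2 (Matrix.of fun i j : Fin 2 => if i.val +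 j.val + 1 = 2 then (1 : L) else 0)).Local v × (UnitaryGroup.cmDatum L 1 (Matrix.of fun i j : Fin 1 => if i.val + j.val + 1 = 1 then (1 : L) else 0)).Local v)) : Set ((UnitaryGroup.cmDatum L 2 (Matrix.of fun i j : Fin 2 => if i.val + j.val + 1 = 2 then (1 : L) else 0)).Local v × (UnitaryGroup.cmDatum L 1 (Matrix.of fun i j : Fin 1 => if i.val + j.val + 1 = 1 then (1 : L) else 0)).Local v))} α₁ →
      Ch12Sec5.IsStableClassFunOn (IsLocalStablyConjH L v) {a : ((UnitaryGroup.cmDatum L 2 (Matrix.of fun i j : Fin 2 => if i.val + j.val + 1 = 2 then (1 : L) else 0)).Local v × (UnitaryGroup.cmDatum L 1 (Matrix.of fun i j : Fin 1 => if i.val + j.val + 1 = 1 then (1 : L) else 0)).Local v) | IsLocalGRegular L v a ∧ IsCompact ((Subgroup.centralizer ({a} : Set ((UnitaryGroup.cmDatum L 2 (Matrix.of fun i j : Fin 2 => if i.val + j.val + 1 = 2 then (1 : L) else 0)).Local v × (UnitaryGroup.cmDatum L 1 (Matrix.of fun i j : Fin 1 => if i.val + j.val + 1 = 1 then (1 :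 L) else 0)).Local v)) : Subgroup ((UnitaryGroup.cmDatum L 2 (Matrix.of fun i j : Fin 2 => if i.val + j.val + 1 = 2 then (1 : L) else 0)).Local v × (UnitaryGroup.cmDatum L 1 (Matrix.of fun i j : Fin 1 => if i.val + j.val + 1 = 1 then (1 : L) else 0)).Local v)) : Set ((UnitaryGroup.cmDatum L 2 (Matrix.of fun i j : Fin 2 => if i.val + j.val + 1 = 2 then (1 : L) else 0)).Local v × (UnitaryGroup.cmDatum L 1 (Matrix.of fun i j : Fin 1 => if i.val + j.val + 1 = 1 then (1 : L) else 0)).Local v))} α₂ →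
      (∀ T' ∈ Sell, Integrable (fun t : ↥T' => ((((NNReal.sqrt (NNReal.sqrt ((∏ w : PlacesOver L v, IsNonarchimedeanLocalField.normAbs (w.1.adicCompletion L) (((((t : Gqs L v)).val : GL (Fin 3) (UnitaryGroup.LocalRing L v)).val.charpoly.discr) w)) * ((∏ w : PlacesOver L v, IsNonarchimedeanLocalField.normAbs (w.1.adicCompletion L) (((((t : Gqs L v)).val : GL (Fin 3) (UnitaryGroup.LocalRing L v)).val.det) w)) ^ 2)⁻¹)) : ℝ≥0) : ℝ) : ℂ)) ^ 2 * (if IsRegularElt (((t : Gqs L v)).val : GL (Fin 3) (UnitaryGroup.LocalRing L v)) then ((((NNReal.sqrt (NNReal.sqrt ((∏ w : PlacesOver L v, IsNonarchimedeanLocalField.normAbs (w.1.adicCompletion L) (((((t : Gqs L v)).val : GL (Fin 3) (UnitaryGroup.LocalRing L v)).val.charpoly.discr) w)) * ((∏ w : PlacesOver L v, IsNonarchimedeanLocalField.normAbs (w.1.adicCompletion L) (((((t : Gqs L v)).val : GL (Fin 3) (UnitaryGroup.LocalRing L v)).val.det) w)) ^ 2)⁻¹)) : ℝ≥0) : ℝ)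 : ℂ))⁻¹ * ∑ᶠ q : Quot (IsLocalStablyConjH L v), (if IsLocalGRegular L v q.out ∧ IsLocalNormPair L (qsForm L) v q.out (t : Gqs L v) then finTau L v q.out μ * (((NNReal.sqrt (NNReal.sqrt ((∏ w : PlacesOver L v, IsNonarchimedeanLocalField.normAbs (w.1.adicCompletion L) (((q.out.1.val : GL (Fin 2) (UnitaryGroup.LocalRing L v)).val.charpoly.discr) w)) * (∏ w : PlacesOver L v, IsNonarchimedeanLocalField.normAbs (w.1.adicCompletion L) (((q.out.1.val : GL (Fin 2) (UnitaryGroup.LocalRing L v)).val.det) w))⁻¹)) : ℝ≥0) : ℝ) : ℂ) * ((finKappaAt L v (qsForm L) q.out (t : Gqs L v) : ℤ) : ℂ) * α₁ q.out else 0) else 0) * starRingEnd ℂ (if IsRegularElt (((t : Gqs L v)).val : GL (Fin 3) (UnitaryGroup.LocalRing L v)) then ((((NNReal.sqrt (NNReal.sqrt ((∏ w : PlacesOver L v, IsNonarchimedeanLocalField.normAbs (w.1.adicCompletion L) (((((t : Gqs L v)).val : GL (Fin 3) (UnitaryGroup.LocalRing L v)).val.charpoly.discr) w)) * ((∏ w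 : PlacesOver L v, IsNonarchimedeanLocalField.normAbs (w.1.adicCompletion L) (((((t : Gqs L v)).val : GL (Fin 3) (UnitaryGroup.LocalRing L v)).val.det) w)) ^ 2)⁻¹)) : ℝ≥0) : ℝ) : ℂ))⁻¹ * ∑ᶠ q : Quot (IsLocalStablyConjH L v), (if IsLocalGRegular L v q.out ∧ IsLocalNormPair L (qsForm L) v q.out (t : Gqs L v) then finTau L v q.out μ * (((NNReal.sqrt (NNReal.sqrt ((∏ w : PlacesOver L v, IsNonarchimedeanLocalField.normAbs (w.1.adicCompletion L) (((q.out.1.val : GL (Fin 2) (UnitaryGroup.LocalRing L v)).val.charpoly.discr) w)) * (∏ w : PlacesOver L v, IsNonarchimedeanLocalField.normAbs (w.1.adicCompletion L) (((q.out.1.val : GL (Fin 2) (UnitaryGroup.LocalRing L v)).val.det) w))⁻¹)) : ℝ≥0) : ℝ) : ℂ) * ((finKappaAt L v (qsForm L) q.out (t : Gqs L v) : ℤ) : ℂ) * α₂ q.out else 0) else 0)) (μTf T')) →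
      (∀ T ∈ SH, Integrable (fun s : ↥T => ((((NNReal.sqrt (NNReal.sqrt ((∏ w : PlacesOver L v, IsNonarchimedeanLocalField.normAbs (w.1.adicCompletion L) (((((s : ((UnitaryGroup.cmDatum L 2 (Matrix.of fun i j : Fin 2 => if i.val + j.val + 1 = 2 then (1 : L) else 0)).Local v × (UnitaryGroup.cmDatum L 1 (Matrix.of fun i j : Fin 1 => if i.val + j.val + 1 = 1 then (1 : L) else 0)).Local v))).1.val : GL (Fin 2) (UnitaryGroup.LocalRing L v)).val.charpoly.discr) w)) * (∏ w : PlacesOver L v, IsNonarchimedeanLocalField.normAbs (w.1.adicCompletion L) (((((s : ((UnitaryGroup.cmDatum L 2 (Matrix.of fun i j : Fin 2 => if i.val + j.val + 1 = 2 then (1 : L) else 0)).Local v × (UnitaryGroup.cmDatum L 1 (Matrix.of fun i j : Fin 1 => if i.val + j.val + 1 = 1 then (1 : L) else 0)).Local v))).1.val : GL (Fin 2) (UnitaryGroup.LocalRing L v)).val.det) w))⁻¹)) : ℝ≥0) : ℝ) : ℂ)) ^ 2 * α₁ (s : ((UnitaryGroup.cmDatum L 2 (Matrix.of fun i j : Fin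 2 => if i.val + j.val + 1 = 2 then (1 : L) else 0)).Local v × (UnitaryGroup.cmDatum L 1 (Matrix.of fun i j : Fin 1 => if i.val + j.val + 1 = 1 then (1 : L) else 0)).Local v)) * starRingEnd ℂ (α₂ (s : ((UnitaryGroup.cmDatum L 2 (Matrix.of fun i j : Fin 2 => if i.val + j.val + 1 = 2 then (1 : L) else 0)).Local v × (UnitaryGroup.cmDatum L 1 (Matrix.of fun i j : Fin 1 => if i.val + j.val + 1 = 1 then (1 : L) else 0)).Local v)))) (μTHf T)) →
      ∑ T' ∈ Sell, (((T'.subgroupOf (Subgroup.normalizer (T' : Set (Gqs L v)))).index : ℂ))⁻¹ * ∫ t : ↥T', ((((NNReal.sqrt (NNReal.sqrt ((∏ w : PlacesOver L v, IsNonarchimedeanLocalField.normAbs (w.1.adicCompletion L) (((((t : Gqs L v)).val : GL (Fin 3) (UnitaryGroup.LocalRing L v)).val.charpoly.discr) w)) * ((∏ w : PlacesOver L v, IsNonarchimedeanLocalField.normAbs (w.1.adicCompletion L) (((((t : Gqs L v)).val : GL (Fin 3) (UnitaryGroup.LocalRing L v)).val.det) w)) ^ 2)⁻¹)) : ℝ≥0)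 : ℝ) : ℂ)) ^ 2 * (if IsRegularElt (((t : Gqs L v)).val : GL (Fin 3) (UnitaryGroup.LocalRing L v)) then ((((NNReal.sqrt (NNReal.sqrt ((∏ w : PlacesOver L v, IsNonarchimedeanLocalField.normAbs (w.1.adicCompletion L) (((((t : Gqs L v)).val : GL (Fin 3) (UnitaryGroup.LocalRing L v)).val.charpoly.discr) w)) * ((∏ w : PlacesOver L v, IsNonarchimedeanLocalField.normAbs (w.1.adicCompletion L) (((((t : Gqs L v)).val : GL (Fin 3) (UnitaryGroup.LocalRing L v)).val.det) w)) ^ 2)⁻¹)) : ℝ≥0) : ℝ) : ℂ))⁻¹ * ∑ᶠ q : Quot (IsLocalStablyConjH L v), (if IsLocalGRegular L v q.out ∧ IsLocalNormPair L (qsForm L) v q.out (t : Gqs L v) then finTau L v q.out μ * (((NNReal.sqrt (NNReal.sqrt ((∏ w : PlacesOver L v, IsNonarchimedeanLocalField.normAbs (w.1.adicCompletion L) (((q.out.1.val : GL (Fin 2) (UnitaryGroup.LocalRing L v)).val.charpoly.discr) w)) * (∏ w : PlacesOver L v, IsNonarchimedeanLocalField.normAbs (w.1.adicCompletion L) (((q.out.1.val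 : GL (Fin 2) (UnitaryGroup.LocalRing L v)).val.det) w))⁻¹)) : ℝ≥0) : ℝ) : ℂ) * ((finKappaAt L v (qsForm L) q.out (t : Gqs L v) : ℤ) : ℂ) * α₁ q.out else 0) else 0) * starRingEnd ℂ (if IsRegularElt (((t : Gqs L v)).val : GL (Fin 3) (UnitaryGroup.LocalRing L v)) then ((((NNReal.sqrt (NNReal.sqrt ((∏ w : PlacesOver L v, IsNonarchimedeanLocalField.normAbs (w.1.adicCompletion L) (((((t : Gqs L v)).val : GL (Fin 3) (UnitaryGroup.LocalRing L v)).val.charpoly.discr) w)) * ((∏ w : PlacesOver L v, IsNonarchimedeanLocalField.normAbs (w.1.adicCompletion L) (((((t : Gqs L v)).val : GL (Fin 3) (UnitaryGroup.LocalRing L v)).val.det) w)) ^ 2)⁻¹)) : ℝ≥0) : ℝ) : ℂ))⁻¹ * ∑ᶠ q : Quot (IsLocalStablyConjH L v), (if IsLocalGRegular L v q.out ∧ IsLocalNormPair L (qsForm L) v q.out (t : Gqs L v) then finTau L v q.out μ * (((NNReal.sqrt (NNReal.sqrt ((∏ w : PlacesOver L v, IsNonarchimedeanLocalField.normAbs (w.1.adicCompletion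 L) (((q.out.1.val : GL (Fin 2) (UnitaryGroup.LocalRing L v)).val.charpoly.discr) w)) * (∏ w : PlacesOver L v, IsNonarchimedeanLocalField.normAbs (w.1.adicCompletion L) (((q.out.1.val : GL (Fin 2) (UnitaryGroup.LocalRing L v)).val.det) w))⁻¹)) : ℝ≥0) : ℝ) : ℂ) * ((finKappaAt L v (qsForm L) q.out (t : Gqs L v) : ℤ) : ℂ) * α₂ q.out else 0) else 0) ∂(μTf T') =
      2 * ∑ T ∈ SH, (((T.subgroupOf (Subgroup.normalizer (T : Set ((UnitaryGroup.cmDatum L 2 (Matrix.of fun i j : Fin 2 => if i.val + j.val + 1 = 2 then (1 : L) else 0)).Local v × (UnitaryGroup.cmDatum L 1 (Matrix.of fun i j : Fin 1 => if i.val + j.val + 1 = 1 then (1 : L) else 0)).Local v)))).index : ℂ))⁻¹ * ∫ s : ↥T, ((((NNReal.sqrt (NNReal.sqrt ((∏ w : PlacesOver L v, IsNonarchimedeanLocalField.normAbs (w.1.adicCompletion L) (((((s : ((UnitaryGroup.cmDatum L 2 (Matrix.of fun i j : Fin 2 => if i.val + j.val + 1 = 2 then (1 : L) else 0)).Local v ×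 (UnitaryGroup.cmDatum L 1 (Matrix.of fun i j : Fin 1 => if i.val + j.val + 1 = 1 then (1 : L) else 0)).Local v))).1.val : GL (Fin 2) (UnitaryGroup.LocalRing L v)).val.charpoly.discr) w)) * (∏ w : PlacesOver L v, IsNonarchimedeanLocalField.normAbs (w.1.adicCompletion L) (((((s : ((UnitaryGroup.cmDatum L 2 (Matrix.of fun i j : Fin 2 => if i.val + j.val + 1 = 2 then (1 : L) else 0)).Local v × (UnitaryGroup.cmDatum L 1 (Matrix.of fun i j : Fin 1 => if i.val + j.val + 1 = 1 then (1 : L) else 0)).Local v))).1.val : GL (Fin 2) (UnitaryGroup.LocalRing L v)).val.det) w))⁻¹)) : ℝ≥0) : ℝ) : ℂ)) ^ 2 * α₁ (s : ((UnitaryGroup.cmDatum L 2 (Matrix.of fun i j : Fin 2 => if i.val + j.val + 1 = 2 then (1 : L) else 0)).Local v × (UnitaryGroup.cmDatum L 1 (Matrix.of fun i j : Fin 1 => if i.val + j.val + 1 = 1 then (1 : L) else 0)).Local v)) * starRingEnd ℂ (α₂ (s : ((UnitaryGroup.cmDatum L 2 (Matrix.of fun i j : Fin 2 => if i.val + j.val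 + 1 = 2 then (1 : L) else 0)).Local v × (UnitaryGroup.cmDatum L 1 (Matrix.of fun i j : Fin 1 => if i.val + j.val + 1 = 1 then (1 : L) else 0)).Local v))) ∂(μTHf T)) :
    𝔇.Prop1252 := by
  intro α₁ α₂ hα₁m hα₂m hα₁st hα₂st hIG hIH
  -- stability on `𝔇.ellH` w.r.t. `𝔇.stConjH` ⇒ stability on the concrete elliptic `G`-regular set w.r.t. ★ `IsLocalStablyConjH`
  have hst : ∀ α : ((UnitaryGroup.cmDatum L 2 (Matrix.of fun i j : Fin 2 => if i.val + j.val + 1 = 2 then (1 : L) else 0)).Local v × (UnitaryGroup.cmDatum L 1 (Matrix.of fun i j : Fin 1 => if i.val + j.val + 1 = 1 then (1 : L) else 0)).Local v) → ℂ, Ch12Sec5.IsStableClassFunOn 𝔇.stConjH 𝔇.ellH α →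
      Ch12Sec5.IsStableClassFunOn (IsLocalStablyConjH L v) {a : ((UnitaryGroup.cmDatum L 2 (Matrix.of fun i j : Fin 2 => if i.val + j.val + 1 = 2 then (1 : L) else 0)).Local v × (UnitaryGroup.cmDatum L 1 (Matrix.of fun i j : Fin 1 => if i.val + j.val + 1 = 1 then (1 : L) else 0)).Local v) | IsLocalGRegular L v a ∧ IsCompact ((Subgroup.centralizer ({a} : Set ((UnitaryGroup.cmDatum L 2 (Matrix.of fun i j : Fin 2 => if i.val + j.val + 1 = 2 then (1 : L) else 0)).Local v × (UnitaryGroup.cmDatum L 1 (Matrix.of fun i j : Fin 1 => if i.val + j.val + 1 = 1 then (1 : L) else 0)).Local v)) : Subgroup ((UnitaryGroup.cmDatum L 2 (Matrix.of fun i j : Fin 2 => if i.val + j.val + 1 = 2 then (1 : L) else 0)).Local v × (UnitaryGroup.cmDatum L 1 (Matrix.of fun i j : Fin 1 => if i.val + j.val + 1 = 1 then (1 : L) else 0)).Local v)) : Set ((UnitaryGroup.cmDatum L 2 (Matrix.of fun i j : Fin 2 => if i.val + j.val + 1 = 2 then (1 : L) else 0)).Local v × (UnitaryGroup.cmDatum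 L 1 (Matrix.of fun i j : Fin 1 => if i.val + j.val + 1 = 1 then (1 : L) else 0)).Local v))} α := fun α h =>
    ⟨fun γ hγ x => h.1 γ ((eEllH γ).2 hγ) x, fun γ hγ γ' h' => h.2 γ ((eEllH γ).2 hγ) γ' ((hStH γ γ').2 h')⟩
  -- the integrands in closed form
  have hG : ∀ T' : Subgroup (Gqs L v),
      (fun t : ↥T' => (𝔇.DG (t : Gqs L v) : ℂ) ^ 2 * 𝔇.up α₁ (t : Gqs L v) * starRingEnd ℂ (𝔇.up α₂ (t : Gqs L v))) =
        fun t : ↥T' => ((((NNReal.sqrt (NNReal.sqrt ((∏ w : PlacesOver L v, IsNonarchimedeanLocalField.normAbs (w.1.adicCompletion L) (((((t : Gqs L v)).val : GL (Fin 3) (UnitaryGroup.LocalRing L v)).val.charpoly.discr) w)) * ((∏ w : PlacesOver L v, IsNonarchimedeanLocalField.normAbs (w.1.adicCompletion L) (((((t : Gqs L v)).val : GL (Fin 3) (UnitaryGroup.LocalRing L v)).val.det) w)) ^ 2)⁻¹)) : ℝ≥0) : ℝ) : ℂ)) ^ 2 * (if IsRegularElt (((t : Gqs L v)).val : GL (Fin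 3) (UnitaryGroup.LocalRing L v)) then ((((NNReal.sqrt (NNReal.sqrt ((∏ w : PlacesOver L v, IsNonarchimedeanLocalField.normAbs (w.1.adicCompletion L) (((((t : Gqs L v)).val : GL (Fin 3) (UnitaryGroup.LocalRing L v)).val.charpoly.discr) w)) * ((∏ w : PlacesOver L v, IsNonarchimedeanLocalField.normAbs (w.1.adicCompletion L) (((((t : Gqs L v)).val : GL (Fin 3) (UnitaryGroup.LocalRing L v)).val.det) w)) ^ 2)⁻¹)) : ℝ≥0) : ℝ) : ℂ))⁻¹ * ∑ᶠ q : Quot (IsLocalStablyConjH L v), (if IsLocalGRegular L v q.out ∧ IsLocalNormPair L (qsForm L) v q.out (t : Gqs L v) then finTau L v q.out μ * (((NNReal.sqrt (NNReal.sqrt ((∏ w : PlacesOver L v, IsNonarchimedeanLocalField.normAbs (w.1.adicCompletion L) (((q.out.1.val : GL (Fin 2) (UnitaryGroup.LocalRing L v)).val.charpoly.discr) w)) * (∏ w : PlacesOver L v, IsNonarchimedeanLocalField.normAbs (w.1.adicCompletion L) (((q.out.1.val : GL (Fin 2) (UnitaryGroup.LocalRing L v)).val.det) w))⁻¹)) :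 ℝ≥0) : ℝ) : ℂ) * ((finKappaAt L v (qsForm L) q.out (t : Gqs L v) : ℤ) : ℂ) * α₁ q.out else 0) else 0) * starRingEnd ℂ (if IsRegularElt (((t : Gqs L v)).val : GL (Fin 3) (UnitaryGroup.LocalRing L v)) then ((((NNReal.sqrt (NNReal.sqrt ((∏ w : PlacesOver L v, IsNonarchimedeanLocalField.normAbs (w.1.adicCompletion L) (((((t : Gqs L v)).val : GL (Fin 3) (UnitaryGroup.LocalRing L v)).val.charpoly.discr) w)) * ((∏ w : PlacesOver L v, IsNonarchimedeanLocalField.normAbs (w.1.adicCompletion L) (((((t : Gqs L v)).val : GL (Fin 3) (UnitaryGroup.LocalRing L v)).val.det) w)) ^ 2)⁻¹)) : ℝ≥0) : ℝ) : ℂ))⁻¹ * ∑ᶠ q : Quot (IsLocalStablyConjH L v), (if IsLocalGRegular L v q.out ∧ IsLocalNormPair L (qsForm L) v q.out (t : Gqs L v) then finTau L v q.out μ * (((NNReal.sqrt (NNReal.sqrt ((∏ w : PlacesOver L v, IsNonarchimedeanLocalField.normAbs (w.1.adicCompletion L) (((q.out.1.val : GL (Fin 2) (UnitaryGroup.LocalRing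 L v)).val.charpoly.discr) w)) * (∏ w : PlacesOver L v, IsNonarchimedeanLocalField.normAbs (w.1.adicCompletion L) (((q.out.1.val : GL (Fin 2) (UnitaryGroup.LocalRing L v)).val.det) w))⁻¹)) : ℝ≥0) : ℝ) : ℂ) * ((finKappaAt L v (qsForm L) q.out (t : Gqs L v) : ℤ) : ℂ) * α₂ q.out else 0) else 0) := by
    intro T'; funext t; simp only [hUp, eDG, eDH]
  have hH : ∀ T : Subgroup ((UnitaryGroup.cmDatum L 2 (Matrix.of fun i j : Fin 2 => if i.val + j.val + 1 = 2 then (1 : L) else 0)).Local v × (UnitaryGroup.cmDatum L 1 (Matrix.of fun i j : Fin 1 => if i.val + j.val + 1 = 1 then (1 : L) else 0)).Local v),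
      (fun s : ↥T => (𝔇.DH (s : ((UnitaryGroup.cmDatum L 2 (Matrix.of fun i j : Fin 2 => if i.val + j.val + 1 = 2 then (1 : L) else 0)).Local v × (UnitaryGroup.cmDatum L 1 (Matrix.of fun i j : Fin 1 => if i.val + j.val + 1 = 1 then (1 : L) else 0)).Local v)) : ℂ) ^ 2 * α₁ (s : ((UnitaryGroup.cmDatum L 2 (Matrix.of fun i j : Fin 2 => if i.val + j.val + 1 = 2 then (1 : L) else 0)).Local v × (UnitaryGroup.cmDatum L 1 (Matrix.of fun i j : Fin 1 => if i.val + j.val + 1 = 1 then (1 : L) else 0)).Local v)) * starRingEnd ℂ (α₂ (s : ((UnitaryGroup.cmDatum L 2 (Matrix.of fun i j : Fin 2 => if i.val + j.val + 1 = 2 then (1 : L) else 0)).Local v × (UnitaryGroup.cmDatum L 1 (Matrix.of fun i j : Fin 1 => if i.val + j.val + 1 = 1 then (1 : L) else 0)).Local v)))) =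
        fun s : ↥T => ((((NNReal.sqrt (NNReal.sqrt ((∏ w : PlacesOver L v, IsNonarchimedeanLocalField.normAbs (w.1.adicCompletion L) (((((s : ((UnitaryGroup.cmDatum L 2 (Matrix.of fun i j : Fin 2 => if i.val + j.val + 1 = 2 then (1 : L) else 0)).Local v × (UnitaryGroup.cmDatum L 1 (Matrix.of fun i j : Fin 1 => if i.val + j.val + 1 = 1 then (1 : L) else 0)).Local v))).1.val : GL (Fin 2) (UnitaryGroup.LocalRing L v)).val.charpoly.discr) w)) * (∏ w : PlacesOver L v, IsNonarchimedeanLocalField.normAbs (w.1.adicCompletion L) (((((s : ((UnitaryGroup.cmDatum L 2 (Matrix.of fun i j : Fin 2 => if i.val + j.val + 1 = 2 then (1 : L) else 0)).Local v × (UnitaryGroup.cmDatum L 1 (Matrix.of fun i j : Fin 1 => if i.val + j.val + 1 = 1 then (1 : L) else 0)).Local v))).1.val : GL (Fin 2) (UnitaryGroup.LocalRing L v)).val.det) w))⁻¹)) : ℝ≥0) : ℝ) : ℂ)) ^ 2 * α₁ (s : ((UnitaryGroup.cmDatum L 2 (Matrix.of fun i j : Fin 2 => if i.val + j.val + 1 =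 2 then (1 : L) else 0)).Local v × (UnitaryGroup.cmDatum L 1 (Matrix.of fun i j : Fin 1 => if i.val + j.val + 1 = 1 then (1 : L) else 0)).Local v)) * starRingEnd ℂ (α₂ (s : ((UnitaryGroup.cmDatum L 2 (Matrix.of fun i j : Fin 2 => if i.val + j.val + 1 = 2 then (1 : L) else 0)).Local v × (UnitaryGroup.cmDatum L 1 (Matrix.of fun i j : Fin 1 => if i.val + j.val + 1 = 1 then (1 : L) else 0)).Local v))) := by
    intro T; funext s; simp only [eDH]
  unfold Ch12Sec5.EllipticData.InnerGDefined at hIG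
  unfold Ch12Sec5.EllipticData.InnerHDefined at hIH
  unfold Ch12Sec5.EllipticData.innerG Ch12Sec5.EllipticData.innerH
  simp only [F0P3cStCharTSEllInnerMeasures.inv_weylOrder_cast_eq_inv_index_cast]
  rw [eCartanG] at hIG
  rw [eCartanH] at hIH
  rw [eCartanG, eCartanH]
  simp only [eMuT, hG] at hIG
  simp only [eMuTH, hH] at hIH
  simp only [eMuT, eMuTH, hG, hH]
  exact hconcrete α₁ α₂ hα₁m hα₂m (hst α₁ hα₁st) (hst α₂ hα₂st) hIG hIH

end Summit.HodgeConjecture.HodgeConjecture.Cruxes.H413.F0P3cStCharTSEllInnerDatumDict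

end
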